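import Literature.AnabelianGeometry.EtaleTheta.FrobenioidThetaOfBiKummerData

/-!
# [EtTh] Lemma 5.9 (ii) at the GENUINE §5 data: `1 → μ_N(B_N) → E_N → Im(Π^tp_Y) → 1` for `ofRootData` / `ofBiKummerData`

Mochizuki, *The étale theta function and its Frobenioid-theoretic manifestations*, Publ. RIMS **45** (2009),
Lemma 5.9 (ii), printed p. 332 (PDF p. 106 of `paper:doi-10-2977-prims-1234361159`, read on the page):
"We have a natural exact sequence `1 → μ_N(B_N) → E_N → Im(Π^tp_Y) → 1` — where `Im(Π^tp_Y)` denotes the image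
of `Π^tp_Y ⊆ Π^tp_X` via the natural outer homomorphism `Π^tp_X ↠ Aut_D(B_N^bs)` [cf. Definition 4.1, (ii)]."
(Proof, p. 332: "Immediate from the definitions".) [cite: MochizukiEtTh2009, Lem 5.9 (ii) p.332 (PDF p.106)]

abc-iut cell, cone node `EtTh:Lem5.9(ii)` (kernel index `Summit.ABC.IUTFork.DAG.N_EtTh_Lem5_9_ii`, part
`N_EtTh_Lem5_9_ii_part`), seat abc-iut-w6-d054 (W6 tranche 2).  PROOF-ONLY companion (no definitions, no instances,
no new `Prop` facts) of the landed files it imports; nothing landed is edited.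

State of the node in the tree (all BY NAME):
* group-theoretic core (abc-iut-L2-t4, `SectionTorsionSubgroup.lean`, p403909): for an abstract datum
  `(p : 𝔄 →* 𝔊, s : 𝔊 →* 𝔄, Y ≤ 𝔊, μ ≤ 𝔄)` with `s` a section of `p` over `Y` and `μ ≤ Ker p` normal — the inclusion
  `μ ≤ E_N` (`le_sectionSubgroup`), surjectivity `p(E_N) = Y` (`sectionSubgroup_map_eq`), exactness in the middle
  `E_N ∩ Ker p = μ` (`sectionSubgroup_inf_ker`), packaged (`sectionSubgroup_exact`) — UNCONDITIONAL;
* §5 vocabulary (abc-iut-L2-t4, `FrobenioidMonoTheta.lean`): `ThetaFrobenioid.ENExact 𝔉` (FACT-LIST F-0537) :=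
  `E_N.map (Aut_C(B_N) → Aut_D(B_N^bs)) = Im(Π^tp_Y̲) ∧ E_N ⊓ Ker = μ_N(B_N)`, PROVED `enExact_of` modulo the section
  property `SgpCapSection` (`(s^⊓-gp_N g)^bs = g`, p. 331) and `Facts.enExact` under the §5 input bundle; the inclusion
  `μ_N(B_N) ≤ E_N` is `muTorsion_le_EN`; the ∀-closure over ALL `𝔉` is refuted at a toy datum whose `s^⊓-gp_N` is not a
  section (`not_forall_enExact`, abc-iut-w4-d034 `Sec5MonoThetaUniversalClosureRefuted.lean`) — a statement about the free
  interface, not about the paper.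

THIS FILE adds the instance form at the GENUINE assembled §5 data of merge row W3-L2-01 (abc-iut-L2-t4,
`FrobenioidThetaOfRootData.lean` / `FrobenioidThetaOfBiKummerData.lean`, p417743), where `s^⊓-gp_N`, `s^⊔-gp_N` ARE the
unique lifts of p. 331 and `SgpCapSection` is a THEOREM (`sgpCapSection_ofRootData` / `sgpCapSection_ofBiKummerData`)
modulo the ONE printed input those constructors carry: the section property `hσ` of the base-Frobenius pair
`σ = s^trv_N : Aut_D(A_N^bs) → Aut_C(A_N)` ([FrdI] Prop. 5.6).  Hence Lemma 5.9 (ii) holds for these data modulo `hσ`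
alone: `enExact_ofRootData`, `enExact_ofBiKummerData` (+ the two conjuncts separately for consumers).
HONEST FRAMING: [EtTh] is refereed; the cell's claim key for the IUT series is `Mochizuki2012` (disputed) — nothing here
bears on [IUTchIII] Cor. 3.12 or takes a side; typed ≠ proved for data not of this form.
-/

noncomputable section

namespace Literature.AnabelianGeometry.EtaleTheta

open CategoryTheory Opposite Literature.AlgebraicGeometry.Frobenioids

namespace ThetaFrobenioid

universe u₀ v₀ u v w u' v'

/-! ### Lemma 5.9 (ii) for `ofRootData` (the §5 data whose sections are the lifts of p. 331) -/

section OfRootData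

variable {C : Type u} [Category.{v} C] {D : Type u'} [Category.{v'} D]
variable (F : FrobenioidTheta.TemperedFrobenioidStub.{w} C D) (Q : FrobenioidTheta.ThetaSubquotientStub.{w} D)
  (l : ℕ) (odd_l : Odd l) (N : ℕ+) (T : ThetaEnvData.{v} N) (Acirc AN BN : C) (sCap sCup : AN ⟶ BN)
  (base_map_sCap : F.pre.base.map sCap = F.pre.base.map sCup)
  (isPreStep_sCap : F.pre.IsPreStep sCap) (isPreStep_sCup : F.pre.IsPreStep sCup)
  (ρ : T.PiX →* Aut (F.pre.base.obj BN)) (ρ_surjective : Function.Surjective ρ)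
  (isOpen_ker_ρ : IsOpen (ρ.ker : Set T.PiX)) (σ : Aut (F.pre.base.obj AN) →* Aut AN)
  (K : Type w) [Field K] (constEmb : Kˣ →* F.biratUnits BN) (constEmb_injective : Function.Injective constEmb)
  (thetaFn : F.biratUnits Acirc)
  (hepi : ∀ ⦃X Y : C⦄ (f : X ⟶ Y), Epi f) (hiso : F.pre.IsOfIsotropicType)
  (hiiid : ∀ ⦃A B B' : C⦄ (φ : A ⟶ B) (φ' : A ⟶ B'), F.pre.IsCoAngularPreStep φ →
    F.pre.IsCoAngularPreStep φ' → F.pre.div φ ∣ F.pre.div φ' →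
      ∃ f : B ⟶ B', F.pre.IsCoAngularPreStep f ∧ φ ≫ f = φ')
  (hdivc : ∀ g : Aut (F.pre.base.obj BN),
    F.pre.div ((σ ((ofRootData.aux F Q l odd_l N T Acirc AN BN sCap sCup base_map_sCap isPreStep_sCap isPreStep_sCup ρ
      ρ_surjective isOpen_ker_ρ σ K constEmb constEmb_injective thetaFn).autBaseIsoAB.symm g)).hom ≫ sCap) = F.pre.div sCap)
  (hdivp : ∀ h : (ofRootData.aux F Q l odd_l N T Acirc AN BN sCap sCup base_map_sCap isPreStep_sCap isPreStep_sCup ρ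
      ρ_surjective isOpen_ker_ρ σ K constEmb constEmb_injective thetaFn).HB,
    F.pre.div ((σ ((ofRootData.aux F Q l odd_l N T Acirc AN BN sCap sCup base_map_sCap isPreStep_sCap isPreStep_sCup ρ
      ρ_surjective isOpen_ker_ρ σ K constEmb constEmb_injective thetaFn).autBaseIsoAB.symm h.1)).hom ≫ sCup) =
      F.pre.div sCup)

/-- **[EtTh] Lemma 5.9 (ii) at `ofRootData`**: for the §5 data whose `s^⊓-gp_N`, `s^⊔-gp_N` are the unique lifts of
p. 331, the sequence `1 → μ_N(B_N) → E_N → Im(Π^tp_Y) → 1` is exact (`ENExact`: the projection `β ↦ β^bs` maps `E_N`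
onto `Im(Π^tp_Y̲)` with kernel `E_N ∩ Ker = μ_N(B_N)`), MODULO the section property `hσ` of `s^trv_N` ([FrdI] Prop. 5.6)
— by `enExact_of` and `sgpCapSection_ofRootData`, BY NAME. [cite: MochizukiEtTh2009, Lem 5.9 (ii) p.332 (PDF p.106)] -/
theorem enExact_ofRootData (hσ : ∀ g : Aut (F.pre.base.obj AN), F.pre.base.mapAut AN (σ g) = g) :
    (ofRootData F Q l odd_l N T Acirc AN BN sCap sCup base_map_sCap isPreStep_sCap isPreStep_sCup ρ ρ_surjective
      isOpen_ker_ρ σ K constEmb constEmb_injective thetaFn hepi hiso hiiid hdivc hdivp).ENExact :=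
  enExact_of _ (sgpCapSection_ofRootData F Q l odd_l N T Acirc AN BN sCap sCup base_map_sCap isPreStep_sCap
    isPreStep_sCup ρ ρ_surjective isOpen_ker_ρ σ K constEmb constEmb_injective thetaFn hepi hiso hiiid hdivc hdivp hσ)

end OfRootData

/-! ### Lemma 5.9 (ii) for `ofBiKummerData` (the §5 data ASSEMBLED from the §3/§4 structures, W3-L2-01) -/

section OfBiKummerData

variable {K : Type u₀} [Field K]
variable {X : SemiGraphs.TemperedArithmeticGroup.{u₀} K} {D₀ : Type u₀} [Category.{v₀} D₀]
  {V : FrdIMonoidStub.{w}} {T₀ : RealifiedDivisorMonoids (D₀ := D₀) V} {D : Type u} [Category.{v} D]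
  {VD : FrdICatStub.{u, v, w} D} {S : BiKummerSetting X T₀ D VD}
  {pullFrac : ∀ {A A' : S.C} (_ : A' ⟶ A), S.biratUnits A → S.biratUnits A'}
  {lv N : ℕ+} {T : ThetaEnvData.{max v w} N} {θ : S.biratUnits S.Aodot} {Bl : S.C}
  {Pl : S.FractionPair θ Bl} {Rl : S.NthRoot θ Pl lv pullFrac}
  (h : ModelFrobenioid.Hypotheses S.tf.divisorMonoid S.tf.ratFnFunctor)
  (toB : ∀ A : S.C, S.biratUnits A →* S.tf.biratUnitsModel A) (Q : FrobenioidTheta.ThetaSubquotientStub.{w} D)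
  (odd_l : Odd (lv : ℕ)) (R : S.NthRoot Rl.root Rl.pair N pullFrac) (ιX : T.PiX ≃ₜ* X.Pi)
  (hopen : IsOpen ((S.galoisSurj R.AN.base R.αData.isGalois).ker : Set X.Pi)) (σ : Aut R.AN.base →* Aut R.AN)
  (K' : Type w) [Field K'] (constEmb : K'ˣ →* S.tf.biratUnitsModel R.BN)
  (constEmb_injective : Function.Injective constEmb)
  (hdivc : ∀ g : Aut R.BN.base,
    ModelFrobenioid.div ((σ ((BiKummerSetting.NthRoot.baseIso S R).conjAut.symm g)).hom ≫ R.pair.num) =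
      ModelFrobenioid.div R.pair.num)
  (hdivp : ∀ y : T.PiYdd,
    ModelFrobenioid.div ((σ (S.galoisSurj R.AN.base R.αData.isGalois (ιX y.1))).hom ≫ R.pair.den) =
      ModelFrobenioid.div R.pair.den)

/-- **[EtTh] Lemma 5.9 (ii) at the assembled §5 data `ofBiKummerData`** (W3-L2-01: `C :=` the setting's model tempered
Frobenioid, `(A_N, B_N, s^⊓_N, s^⊔_N) :=` the `N`-th root `R` of the fraction-pair of the `l`-th root of `Θ̈`,
`ρ := rhoOfBiKummerData`, `s^trv_N := σ`): the sequence `1 → μ_N(B_N) → E_N → Im(Π^tp_Y) → 1` is exact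
(`ENExact`), MODULO the section property `hσ` of `σ` ([FrdI] Prop. 5.6) — by `enExact_of` and
`sgpCapSection_ofBiKummerData`, BY NAME. [cite: MochizukiEtTh2009, Lem 5.9 (ii) p.332 (PDF p.106)] -/
theorem enExact_ofBiKummerData (hσ : ∀ g : Aut R.AN.base, ModelFrobenioid.baseMap (σ g).hom = g.hom) :
    (ofBiKummerData h toB Q odd_l R ιX hopen σ K' constEmb constEmb_injective hdivc hdivp).ENExact :=
  enExact_of _ (sgpCapSection_ofBiKummerData h toB Q odd_l R ιX hopen σ K' constEmb constEmb_injective hdivc hdivp hσ)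

/-- Lemma 5.9 (ii) at `ofBiKummerData`, SURJECTIVITY clause: `E_N ↠ Im(Π^tp_Y̲)` — the image of `E_N` under
`Aut_C(B_N) → Aut_D(B_N^bs)` is exactly `Im(Π^tp_Y̲)` (modulo `hσ`). [cite: MochizukiEtTh2009, Lem 5.9 (ii) p.332 (PDF p.106)] -/
theorem EN_map_autBase_ofBiKummerData (hσ : ∀ g : Aut R.AN.base, ModelFrobenioid.baseMap (σ g).hom = g.hom) :
    (ofBiKummerData h toB Q odd_l R ιX hopen σ K' constEmb constEmb_injective hdivc hdivp).EN.map
        ((ofBiKummerData h toB Q odd_l R ιX hopen σ K' constEmb constEmb_injective hdivc hdivp).autBase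
          (ofBiKummerData h toB Q odd_l R ιX hopen σ K' constEmb constEmb_injective hdivc hdivp).BN) =
      (ofBiKummerData h toB Q odd_l R ιX hopen σ K' constEmb constEmb_injective hdivc hdivp).imPiY :=
  (enExact_ofBiKummerData h toB Q odd_l R ιX hopen σ K' constEmb constEmb_injective hdivc hdivp hσ).1

/-- Lemma 5.9 (ii) at `ofBiKummerData`, EXACTNESS IN THE MIDDLE: the kernel of `E_N → Im(Π^tp_Y̲)` is precisely the
cyclotome, `E_N ∩ Ker(Aut_C(B_N) → Aut_D(B_N^bs)) = μ_N(B_N)` (modulo `hσ`); together with the inclusion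
`μ_N(B_N) ≤ E_N` (`muTorsion_le_EN`) this is the printed exact sequence. [cite: MochizukiEtTh2009, Lem 5.9 (ii) p.332 (PDF p.106)] -/
theorem EN_inf_ker_ofBiKummerData (hσ : ∀ g : Aut R.AN.base, ModelFrobenioid.baseMap (σ g).hom = g.hom) :
    (ofBiKummerData h toB Q odd_l R ιX hopen σ K' constEmb constEmb_injective hdivc hdivp).EN ⊓
        ((ofBiKummerData h toB Q odd_l R ιX hopen σ K' constEmb constEmb_injective hdivc hdivp).autBase
          (ofBiKummerData h toB Q odd_l R ιX hopen σ K' constEmb constEmb_injective hdivc hdivp).BN).ker =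
      (ofBiKummerData h toB Q odd_l R ιX hopen σ K' constEmb constEmb_injective hdivc hdivp).muTorsion
        (ofBiKummerData h toB Q odd_l R ιX hopen σ K' constEmb constEmb_injective hdivc hdivp).BN
        (ofBiKummerData h toB Q odd_l R ιX hopen σ K' constEmb constEmb_injective hdivc hdivp).N :=
  (enExact_ofBiKummerData h toB Q odd_l R ιX hopen σ K' constEmb constEmb_injective hdivc hdivp hσ).2

end OfBiKummerData

end ThetaFrobenioid

end Literature.AnabelianGeometry.EtaleTheta

end
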